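import Mathlib
import Summits.ValiantsHypothesis.ValiantsHypothesis.Theses.PartialSorting
import Summits.ValiantsHypothesis.ValiantsHypothesis.Theorems.PartialSortingSmoothIsBoardPatterns
import Summits.ValiantsHypothesis.ValiantsHypothesis.Theorems.PartialSortingSmoothIsBoardRank

/-!
# PartialSorting — `SmoothIsBoard` (item stmt-ValiantsHypothesis-13597): smooth Bruhat ideals are boards

We prove the route decl `SmoothIsBoard` of `Theses/PartialSorting.lean`: if `w ∈ S_n` avoids the
patterns `4231, 35142, 42513, 351624` (Gasharov–Reiner's permutations "defined by inclusions"),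
then there is a board `B ⊆ [n] × [n]` with `σ ≤ w ↔ ∀ a, (a, σ a) ∈ B` for all `σ ∈ S_n`, where
`σ ≤ w` is the Björner–Brenti rank criterion `σ[i,j] ≤ w[i,j]` (`p[i,j] = #{a ≤ i : j ≤ p a}`,
BjornerBrenti2005 Thm 2.1.5) exactly as inlined in the route file.  This is the "if" direction
of Sjöstrand's theorem (J. Sjöstrand, *Bruhat intervals as rooks on skew Ferrers boards*,
JCTA 114 (2007), doi:10.1016/j.jcta.2007.01.001, Thm 3.1), with `B` the *right hull* of `w`:
the squares having a rook of `w` weakly north-east and a rook of `w` weakly south-west.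

Proof layout (following Sjöstrand, whose last step copies Gasharov–Reiner 2002, Thm 4.2):
* `PartialSortingSmoothIsBoardRank`: counting identities for `p[i,j]` and the easy direction
  (`ne_witness`, `sw_witness`);
* here, `exists_L` / `exists_essential`: if all rooks of `σ` lie in the hull but `σ ≰ w`, a
  maximal element `(I, J)` of Sjöstrand's set `L` is an essential square of `w` with rooks of
  `w` weakly north-east and strictly south-west of it;
* `PartialSortingSmoothIsBoardPatterns.pattern_of_essential`: such a square yields one of the
  four patterns — contradiction.
The combinatorial decomposition was brute-force checked for `n ≤ 8` before formalisation.
-/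

-- `Summit.ValiantsHypothesis.ValiantsHypothesis.…` is the tree's mandated single-conjunct layout
-- (Sub = Summit), so the duplicated namespace component is intended.
set_option linter.dupNamespace false

namespace Summit.ValiantsHypothesis.ValiantsHypothesis.Theorems.PartialSortingSmoothIsBoard

open Finset
open Summit.ValiantsHypothesis.ValiantsHypothesis.Theorems.PartialSortingSmoothIsBoardRank
open Summit.ValiantsHypothesis.ValiantsHypothesis.Theorems.PartialSortingSmoothIsBoardPatterns

variable {n : ℕ}

/-! ## Sjöstrand's essential square -/

/-- Sjöstrand's set `L` is nonempty: from a square where the rank inequality `σ[i,j] ≤ w[i,j]`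
fails, walking north / east while it keeps failing, one reaches such a square with moreover
`w i < j` and no rook of `w` in column `j` weakly above row `i`. -/
theorem exists_L (w σ : Equiv.Perm (Fin n))
    (hbad : ∃ i j : Fin n, (univ.filter (fun a => a ≤ i ∧ j ≤ w a)).card <
      (univ.filter (fun a => a ≤ i ∧ j ≤ σ a)).card) :
    ∃ i j : Fin n, (univ.filter (fun a => a ≤ i ∧ j ≤ w a)).card <
      (univ.filter (fun a => a ≤ i ∧ j ≤ σ a)).card ∧ w i < j ∧ ∀ a, a ≤ i → w a ≠ j := by
  classical
  obtain ⟨i₀, j₀, h₀⟩ := hbad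
  -- minimise `μ(i,j) = i + (n - 1 - j)` over the squares where the inequality fails
  set S : Finset (Fin n × Fin n) := univ.filter (fun x : Fin n × Fin n =>
    (univ.filter (fun a => a ≤ x.1 ∧ x.2 ≤ w a)).card <
      (univ.filter (fun a => a ≤ x.1 ∧ x.2 ≤ σ a)).card) with hS
  have hne : S.Nonempty := ⟨(i₀, j₀), by simp [hS, h₀]⟩
  obtain ⟨⟨i, j⟩, hmem, hmin⟩ :=
    S.exists_min_image (fun x : Fin n × Fin n => (x.1 : ℕ) + (n - 1 - x.2)) hne
  have hij : (univ.filter (fun a => a ≤ i ∧ j ≤ w a)).card <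
      (univ.filter (fun a => a ≤ i ∧ j ≤ σ a)).card := by simpa [hS] using hmem
  refine ⟨i, j, hij, ?_, ?_⟩
  · -- `w i < j`: otherwise the square `(i-1, j)` fails too
    by_contra hcon
    rw [not_lt] at hcon
    have hi0 : (i : ℕ) ≠ 0 := by
      intro hi0
      have hσ := ne_le_row σ i j
      have hw : 0 < (univ.filter (fun a => a ≤ i ∧ j ≤ w a)).card :=
        card_pos.mpr ⟨i, by simp [hcon]⟩
      omega
    obtain ⟨i', hi'⟩ : ∃ i' : Fin n, (i : ℕ) = i' + 1 := ⟨⟨(i : ℕ) - 1, by omega⟩, by simp; omega⟩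
    have hrow_w := ne_row_succ w i' i j hi'
    have hrow_σ := ne_row_succ σ i' i j hi'
    rw [if_pos hcon] at hrow_w
    have hbad' : (univ.filter (fun a => a ≤ i' ∧ j ≤ w a)).card <
        (univ.filter (fun a => a ≤ i' ∧ j ≤ σ a)).card := by
      split_ifs at hrow_σ <;> omega
    have hle := hmin (i', j) (by simp [hS, hbad'])
    simp only at hle
    omega
  · -- no rook of `w` in column `j` weakly above row `i`: otherwise `(i, j+1)` fails too
    intro a ha hwa
    have hjn : (j : ℕ) + 1 < n := by
      by_contra hjn
      have hσ := ne_le_col σ i j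
      have hw : 0 < (univ.filter (fun a => a ≤ i ∧ j ≤ w a)).card :=
        card_pos.mpr ⟨a, by simp [ha, hwa]⟩
      omega
    obtain ⟨j', hj'⟩ : ∃ j' : Fin n, (j' : ℕ) = j + 1 := ⟨⟨(j : ℕ) + 1, hjn⟩, rfl⟩
    have hcol_w := ne_col_succ w i j j' hj'
    have hcol_σ := ne_col_succ σ i j j' hj'
    rw [card_row_eq_one w i j a ha hwa] at hcol_w
    have h1 := card_row_eq_le_one σ i j
    have hbad' : (univ.filter (fun a => a ≤ i ∧ j' ≤ w a)).card <
        (univ.filter (fun a => a ≤ i ∧ j' ≤ σ a)).card := by omega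
    have hle := hmin (i, j') (by simp [hS, hbad'])
    simp only at hle
    omega

/-- **Sjöstrand's essential square** (doi:10.1016/j.jcta.2007.01.001, proof of Thm 3.1).
If every rook of `σ` lies in the right hull of `w` but `σ ≰ w` in the rank criterion, then there
is an essential square `(I, J)` of `w` — `w I < J ≤ w (I+1)`, the value `J-1` taken at a row
`≤ I`, the value `J` not taken at rows `≤ I` — together with a rook of `w` weakly north-east of
`(I, J)` and a rook of `w` strictly south-west of it.  (`(I, J)` is a maximal element of the set
`L` of `exists_L`; the two rooks of `w` come from rooks of `σ` in the two regions, which exist by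
counting, via the hull hypothesis.) -/
theorem exists_essential (w σ : Equiv.Perm (Fin n))
    (hB : ∀ a : Fin n, (∃ a', a' ≤ a ∧ σ a ≤ w a') ∧ (∃ a', a ≤ a' ∧ w a' ≤ σ a))
    (hbad : ∃ i j : Fin n, (univ.filter (fun a => a ≤ i ∧ j ≤ w a)).card <
      (univ.filter (fun a => a ≤ i ∧ j ≤ σ a)).card) :
    ∃ I I1 J J1 : Fin n, (I1 : ℕ) = I + 1 ∧ (J : ℕ) = J1 + 1 ∧ w I < J ∧ J ≤ w I1 ∧
      (∃ a₀, a₀ ≤ I ∧ w a₀ = J1) ∧ (∀ a, a ≤ I → w a ≠ J) ∧ (∃ i, i ≤ I ∧ J ≤ w i) ∧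
      (∃ i', I < i' ∧ w i' < J) := by
  classical
  obtain ⟨i₀, j₀, h₀, h₀', h₀''⟩ := exists_L w σ hbad
  -- maximise `μ(i,j) = i + (n - 1 - j)` over Sjöstrand's set `L`
  set L : Finset (Fin n × Fin n) := univ.filter (fun x : Fin n × Fin n =>
    (univ.filter (fun a => a ≤ x.1 ∧ x.2 ≤ w a)).card <
      (univ.filter (fun a => a ≤ x.1 ∧ x.2 ≤ σ a)).card ∧
    w x.1 < x.2 ∧ ∀ a, a ≤ x.1 → w a ≠ x.2) with hLdef
  have hne : L.Nonempty :=
    ⟨(i₀, j₀), by simp only [hLdef, mem_filter, mem_univ, true_and]; exact ⟨h₀, h₀', h₀''⟩⟩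
  obtain ⟨⟨I, J⟩, hmem, hmax⟩ :=
    L.exists_max_image (fun x : Fin n × Fin n => (x.1 : ℕ) + (n - 1 - x.2)) hne
  have hL : (univ.filter (fun a => a ≤ I ∧ J ≤ w a)).card <
      (univ.filter (fun a => a ≤ I ∧ J ≤ σ a)).card ∧
      w I < J ∧ ∀ a, a ≤ I → w a ≠ J := by simpa [hLdef] using hmem
  obtain ⟨hIJ, hwI, hcol⟩ := hL
  -- `I` is not the last row and `J` is not the first column
  have hIn : (I : ℕ) + 1 < n := by
    by_contra h
    have e1 := ne_last_row w I J (by omega)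
    have e2 := ne_last_row σ I J (by omega)
    omega
  have hJ0 : (J : ℕ) ≠ 0 := by
    intro h
    have e1 := ne_first_col w I J h
    have e2 := ne_first_col σ I J h
    omega
  obtain ⟨I1, hI1⟩ : ∃ I1 : Fin n, (I1 : ℕ) = I + 1 := ⟨⟨(I : ℕ) + 1, hIn⟩, rfl⟩
  obtain ⟨J1, hJ1⟩ : ∃ J1 : Fin n, (J : ℕ) = J1 + 1 := ⟨⟨(J : ℕ) - 1, by omega⟩, by simp; omega⟩
  refine ⟨I, I1, J, J1, hI1, hJ1, hwI, ?_, ?_, hcol, ?_, ?_⟩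
  · -- `J ≤ w (I+1)`: otherwise `(I+1, J) ∈ L`, contradicting maximality
    by_contra hcon
    rw [not_le] at hcon
    have hrow_w := ne_row_succ w I I1 J hI1
    have hrow_σ := ne_row_succ σ I I1 J hI1
    rw [if_neg (not_le.mpr hcon)] at hrow_w
    have hmemL : (I1, J) ∈ L := by
      simp only [hLdef, mem_filter, mem_univ, true_and]
      refine ⟨by split_ifs at hrow_σ <;> omega, hcon, ?_⟩
      intro a ha
      by_cases haI : a = I1
      · rw [haI]; exact hcon.ne
      · exact hcol a (by omega)
    have hle := hmax (I1, J) hmemL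
    simp only at hle
    omega
  · -- the value `J-1` is taken at a row `≤ I`: otherwise `(I, J-1) ∈ L`
    by_contra hcon
    push Not at hcon
    have hcol_w := ne_col_succ w I J1 J hJ1
    have hcol_σ := ne_col_succ σ I J1 J hJ1
    rw [card_row_eq_zero w I J1 hcon] at hcol_w
    have hmemL : (I, J1) ∈ L := by
      simp only [hLdef, mem_filter, mem_univ, true_and]
      refine ⟨by omega, ?_, hcon⟩
      have h' := hcon I le_rfl
      have h'' : (w I : ℕ) ≠ J1 := fun e => h' (Fin.ext e)
      omega
    have hle := hmax (I, J1) hmemL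
    simp only at hle
    omega
  · -- a rook of `w` weakly north-east of `(I, J)`, from a rook of `σ` there and the hull
    have hpos : 0 < (univ.filter (fun a => a ≤ I ∧ J ≤ σ a)).card := by omega
    obtain ⟨a₁, ha₁⟩ := card_pos.mp hpos
    simp only [mem_filter, mem_univ, true_and] at ha₁
    obtain ⟨a', ha', hv⟩ := (hB a₁).1
    exact ⟨a', ha'.trans ha₁.1, ha₁.2.trans hv⟩
  · -- a rook of `w` strictly south-west of `(I, J)`, by the complementary count and the hull
    have e1 := sw_count w I J
    have e2 := sw_count σ I J
    have hpos : 0 < (univ.filter (fun a => I < a ∧ σ a < J)).card := by omega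
    obtain ⟨a₂, ha₂⟩ := card_pos.mp hpos
    simp only [mem_filter, mem_univ, true_and] at ha₂
    obtain ⟨a', ha', hv⟩ := (hB a₂).2
    exact ⟨a', lt_of_lt_of_le ha₂.1 ha', lt_of_le_of_lt hv ha₂.2⟩

/-! ## The theorem -/

/-- **SmoothIsBoard** (item stmt-ValiantsHypothesis-13597 of route PartialSorting; Sjöstrand 2007,
doi:10.1016/j.jcta.2007.01.001, Thm 3.1, "if" direction; Gasharov–Reiner 2002, Thm 4.2).
If `w ∈ S_n` avoids the patterns `4231, 35142, 42513, 351624`, then the lower Bruhat interval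
`[e, w]` (rank criterion `σ[i,j] ≤ w[i,j]`, `p[i,j] = #{a ≤ i : j ≤ p a}`) is a *board*: with
`B :=` the right hull of `w` — the squares `(i, j)` having a rook `(a, w a)` of `w` weakly
north-east (`a ≤ i`, `j ≤ w a`) and one weakly south-west (`i ≤ a`, `w a ≤ j`) — one has
`σ ≤ w ↔ ∀ a, (a, σ a) ∈ B`.  Direction `→` holds for every `w` (`ne_witness`, `sw_witness`);
for `←`, if all rooks of `σ` are in `B` but `σ ≰ w`, `exists_essential` produces an essential
square of `w` with rooks of `w` on both sides, and `pattern_of_essential` extracts one of the four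
forbidden patterns from it. -/
theorem smoothIsBoard_proof :
    Summit.ValiantsHypothesis.ValiantsHypothesis.Theses.PartialSorting.SmoothIsBoard := by
  unfold Summit.ValiantsHypothesis.ValiantsHypothesis.Theses.PartialSorting.SmoothIsBoard
  intro n w h4231 h35142 h42513 h351624
  classical
  refine ⟨univ.filter (fun x : Fin n × Fin n =>
    (∃ a, a ≤ x.1 ∧ x.2 ≤ w a) ∧ (∃ a, x.1 ≤ a ∧ w a ≤ x.2)), fun σ => ⟨?_, ?_⟩⟩
  · -- `σ ≤ w ⇒` every rook of `σ` is in the hull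
    intro hle a
    simp only [mem_filter, mem_univ, true_and]
    exact ⟨ne_witness w σ hle a, sw_witness w σ hle a⟩
  · -- rooks in the hull and `σ ≰ w ⇒` a forbidden pattern
    intro hmem
    by_contra hnot
    push Not at hnot
    have hB : ∀ a : Fin n, (∃ a', a' ≤ a ∧ σ a ≤ w a') ∧ (∃ a', a ≤ a' ∧ w a' ≤ σ a) := by
      intro a
      have h := hmem a
      simpa only [mem_filter, mem_univ, true_and] using h
    obtain ⟨I, I1, J, J1, hI1, hJ1, h1, h2, ⟨a₀, ha₀, ha₀v⟩, h4, ⟨i, hi, hiv⟩, ⟨i', hi', hi'v⟩⟩ :=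
      exists_essential w σ hB hnot
    rcases pattern_of_essential w I I1 J J1 hI1 hJ1 h1 h2 a₀ ha₀ ha₀v h4 i hi hiv i' hi' hi'v
      with h | h | h | h
    · exact h4231 h
    · exact h35142 h
    · exact h42513 h
    · exact h351624 h

end Summit.ValiantsHypothesis.ValiantsHypothesis.Theorems.PartialSortingSmoothIsBoard
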